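import Summits.Ventures.PercRepro.ProfilePointedCaptured

/-!
# PercRepro — THE COLOOP LIMIT (L1) OF THE `p`-AVOIDING HALF IS THE CAPTURED FIRST MOMENT (C1′)
(p10, gen 15; `proofs/P10-AVFULL.md` §22(g), §23)

For a finite matroid `M` on `N = #E` elements and a point `p ∈ E`, the coloop limit of (A1) (`PointedRowOut`) at the
middle level is the first-moment inequality

  (L1)  `Σ_k (2k − N) · in_k ≤ Σ_k c^p_k`          (`PointedLimitIn`, NOT asserted),

«the bias of `p` is at most the probability that `p` is not captured» (gen 14, §22(g)).  This file proves, in the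
kernel, that (L1) is EQUIVALENT to (C1′) `N · Σ_k κ_k ≤ 2 · Σ_k k · κ_k` (`CapLimit`): the complementation
`X ↦ E ∖ X` gives `Σ_k (2k − N) · P_k = 0` (`sum_signed_card_biIndepSets`), so `Σ_k (2k − N) · in_k = −Σ_k (2k − N) · out_k`;
`out = κ + c^p`; and the symmetry `c^p_k = c^p_{N−1−k}` of the bi-independent sets of `M / p` on `N − 1` elements
(`extCount_symm`) gives `Σ_k (2k − N) · c^p_k = −Σ_k c^p_k` (`sum_signed_extCount`).  Hence

  `Σ_k (2k − N) · in_k − Σ_k c^p_k = −Σ_k (2k − N) · κ_k`,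

and (L1) ⟺ (C1′) (`pointedLimitIn_iff_capLimit`).  Nothing here asserts (L1) or (C1′).
-/

open scoped Matroid

namespace PercRepro.Cogirth

open Finset ThmH Skew

variable {α : Type} [DecidableEq α] {M : Matroid α} [M.Finite]

/-- **(L1), THE COLOOP LIMIT OF (A1) (NOT asserted)**: for every finite matroid on `α` and every point `p`,
`Σ_k (2k − N) · in_k ≤ Σ_k c^p_k` (sums over `0 ≤ k ≤ N`, in `ℤ`). -/
def PointedLimitIn (α : Type) [DecidableEq α] : Prop :=
  ∀ (M : Matroid α) [M.Finite] (p : α), p ∈ gr M →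
    ∑ k ∈ range ((gr M).card + 1), ((2 * (k : ℤ) - (gr M).card) * (inCount M k p : ℤ)) ≤
      ∑ k ∈ range ((gr M).card + 1), (extCount M k p : ℤ)

/-- A signed sum over `0 … N` against a sequence symmetric under `k ↦ N − k` vanishes:
`Σ_k (2k − N) · g k = 0` when `g k = g (N − k)` for `k ≤ N`. -/
theorem sum_signed_symm (N : ℕ) (g : ℕ → ℕ) (hg : ∀ k, k ≤ N → g k = g (N - k)) :
    ∑ k ∈ range (N + 1), ((2 * (k : ℤ) - N) * (g k : ℤ)) = 0 := by
  have hrefl : ∑ k ∈ range (N + 1), ((2 * (k : ℤ) - N) * (g k : ℤ)) =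
      ∑ k ∈ range (N + 1), ((2 * ((N - k : ℕ) : ℤ) - N) * (g (N - k) : ℤ)) := by
    rw [← sum_range_reflect (fun k => (2 * (k : ℤ) - N) * (g k : ℤ)) (N + 1)]
    apply sum_congr rfl
    intro k hk
    rw [mem_range] at hk
    rw [show N + 1 - 1 - k = N - k by omega]
  have h2 : 2 * ∑ k ∈ range (N + 1), ((2 * (k : ℤ) - N) * (g k : ℤ)) = 0 := by
    rw [two_mul]
    nth_rewrite 2 [hrefl]
    rw [← sum_add_distrib]
    apply sum_eq_zero
    intro k hk
    rw [mem_range] at hk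
    have hcast : ((N - k : ℕ) : ℤ) = (N : ℤ) - (k : ℤ) := by
      rw [Nat.cast_sub (by omega)]
    rw [hcast, ← hg k (by omega)]
    ring
  linarith

/-- Complementation: `Σ_k (2k − N) · P_k = 0`. -/
theorem sum_signed_card_biIndepSets (M : Matroid α) [M.Finite] :
    ∑ k ∈ range ((gr M).card + 1), ((2 * (k : ℤ) - (gr M).card) * ((biIndepSets M k).card : ℤ)) = 0 :=
  sum_signed_symm (gr M).card (fun k => (biIndepSets M k).card)
    (fun _ hk => card_biIndepSets_symm M hk)

/-- `c^p_k = 0` above the ground set: no bi-independent `N`-set avoids `p ∈ E`. -/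
theorem extCount_top {p : α} (hp : p ∈ gr M) : extCount M (gr M).card p = 0 := by
  unfold extCount
  rw [card_eq_zero, filter_eq_empty_iff]
  intro X hX hpX
  rw [mem_biIndepSets] at hX
  have hXeq : X = gr M := eq_of_subset_of_card_le hX.1 (by rw [hX.2.1])
  exact hpX.1 (hXeq ▸ hp)

/-- The symmetry of the compensation: `c^p_k = c^p_{N−1−k}` for `k ≤ N − 1` (bi-independent sets of `M / p` on
`N − 1` elements, complemented). -/
theorem extCount_symm {p : α} (hp : p ∈ gr M) (k : ℕ) (hk : k + 1 ≤ (gr M).card) :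
    extCount M k p = extCount M ((gr M).card - 1 - k) p := by
  by_cases hp1 : M.Indep {p}
  · rw [extCount_eq_card_biIndepSets_contract hp1 k,
      extCount_eq_card_biIndepSets_contract hp1 ((gr M).card - 1 - k)]
    have hN : (gr (M ／ ({p} : Set α))).card = (gr M).card - 1 := by
      rw [gr_contract', card_erase_of_mem hp]
    have hs := card_biIndepSets_symm (M ／ ({p} : Set α)) (k := k) (by rw [hN]; omega)
    rw [hN] at hs
    exact hs
  · rw [extCount_eq_zero_of_not_indep hp1, extCount_eq_zero_of_not_indep hp1]

/-- `Σ_k (2k − N) · c^p_k = −Σ_k c^p_k`: the signed sum against the `(N − 1)`-symmetric sequence `c^p`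
(the last term `k = N` vanishes). -/
theorem sum_signed_extCount {p : α} (hp : p ∈ gr M) :
    ∑ k ∈ range ((gr M).card + 1), ((2 * (k : ℤ) - (gr M).card) * (extCount M k p : ℤ)) =
      - ∑ k ∈ range ((gr M).card + 1), (extCount M k p : ℤ) := by
  rcases Nat.eq_zero_or_pos (gr M).card with h0 | hpos
  · exfalso
    rw [card_eq_zero] at h0
    rw [h0] at hp
    exact notMem_empty p hp
  obtain ⟨N', hN'⟩ : ∃ N', (gr M).card = N' + 1 := ⟨(gr M).card - 1, by omega⟩
  -- split off the last term k = N, which is 0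
  have htop : extCount M (gr M).card p = 0 := extCount_top hp
  rw [hN'] at htop ⊢
  have hL : ∑ k ∈ range (N' + 1 + 1), ((2 * (k : ℤ) - ((N' + 1 : ℕ) : ℤ)) * (extCount M k p : ℤ)) =
      ∑ k ∈ range (N' + 1), ((2 * (k : ℤ) - ((N' + 1 : ℕ) : ℤ)) * (extCount M k p : ℤ)) := by
    rw [sum_range_succ, htop]
    simp only [Nat.cast_zero, mul_zero, add_zero]
  have hR : ∑ k ∈ range (N' + 1 + 1), (extCount M k p : ℤ) = ∑ k ∈ range (N' + 1), (extCount M k p : ℤ) := by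
    rw [sum_range_succ, htop]
    simp only [Nat.cast_zero, add_zero]
  rw [hL, hR]
  -- the symmetric sum over 0 … N' with g k = c_k, g k = g (N' - k)
  have hsym := sum_signed_symm N' (fun k => extCount M k p) (fun k hk => by
    have := extCount_symm hp k (by omega)
    rw [hN', show N' + 1 - 1 - k = N' - k by omega] at this
    exact this)
  -- Σ (2k − (N'+1)) c_k = Σ (2k − N') c_k − Σ c_k = −Σ c_k
  have hsplit : ∑ k ∈ range (N' + 1), ((2 * (k : ℤ) - ((N' + 1 : ℕ) : ℤ)) * (extCount M k p : ℤ)) =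
      ∑ k ∈ range (N' + 1), ((2 * (k : ℤ) - N') * (extCount M k p : ℤ)) -
        ∑ k ∈ range (N' + 1), (extCount M k p : ℤ) := by
    rw [← sum_sub_distrib]
    apply sum_congr rfl
    intro k _
    push_cast
    ring
  rw [hsplit, hsym]
  ring

/-- **(L1) ⟺ (C1′)**: `Σ_k (2k − N) · in_k − Σ_k c^p_k = −Σ_k (2k − N) · κ_k` for every `M` and `p`. -/
theorem sum_signed_inCount_sub (M : Matroid α) [M.Finite] {p : α} (hp : p ∈ gr M) :
    ∑ k ∈ range ((gr M).card + 1), ((2 * (k : ℤ) - (gr M).card) * (inCount M k p : ℤ)) -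
        ∑ k ∈ range ((gr M).card + 1), (extCount M k p : ℤ) =
      - ∑ k ∈ range ((gr M).card + 1), ((2 * (k : ℤ) - (gr M).card) * (capCount M k p : ℤ)) := by
  have hP := sum_signed_card_biIndepSets M
  have hc := sum_signed_extCount hp
  have hsplit : ∀ k, ((biIndepSets M k).card : ℤ) = (inCount M k p : ℤ) + (capCount M k p : ℤ) +
      (extCount M k p : ℤ) := by
    intro k
    rw [← inCount_add_outCount M k p, ← capCount_add_extCount k hp]
    push_cast
    ring
  simp_rw [hsplit, mul_add, sum_add_distrib] at hP
  linarith

/-- **THE COLOOP LIMIT OF (A1) IS THE CAPTURED FIRST MOMENT**: (L1) ⟺ (C1′), for every type `α`. -/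
theorem pointedLimitIn_iff_capLimit : PointedLimitIn α ↔ CapLimit α := by
  constructor
  · intro h M _ p hp
    have h1 := h M p hp
    have h2 := sum_signed_inCount_sub M hp
    have h3 : 0 ≤ ∑ k ∈ range ((gr M).card + 1), ((2 * (k : ℤ) - (gr M).card) * (capCount M k p : ℤ)) := by
      linarith
    have h4 : ∑ k ∈ range ((gr M).card + 1), ((2 * (k : ℤ) - (gr M).card) * (capCount M k p : ℤ)) =
        2 * ((∑ k ∈ range ((gr M).card + 1), k * capCount M k p : ℕ) : ℤ) -
          ((gr M).card : ℤ) * ((∑ k ∈ range ((gr M).card + 1), capCount M k p : ℕ) : ℤ) := by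
      push_cast
      rw [mul_sum, mul_sum, ← sum_sub_distrib]
      apply sum_congr rfl
      intro k _
      ring
    rw [h4] at h3
    have h5 : (((gr M).card * ∑ k ∈ range ((gr M).card + 1), capCount M k p : ℕ) : ℤ) ≤
        ((2 * ∑ k ∈ range ((gr M).card + 1), k * capCount M k p : ℕ) : ℤ) := by
      push_cast
      push_cast at h3
      linarith
    exact_mod_cast h5
  · intro h M _ p hp
    have h1 := h M p hp
    have h2 := sum_signed_inCount_sub M hp
    have h4 : ∑ k ∈ range ((gr M).card + 1), ((2 * (k : ℤ) - (gr M).card) * (capCount M k p : ℤ)) =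
        2 * ((∑ k ∈ range ((gr M).card + 1), k * capCount M k p : ℕ) : ℤ) -
          ((gr M).card : ℤ) * ((∑ k ∈ range ((gr M).card + 1), capCount M k p : ℕ) : ℤ) := by
      push_cast
      rw [mul_sum, mul_sum, ← sum_sub_distrib]
      apply sum_congr rfl
      intro k _
      ring
    have h5 : ((gr M).card : ℤ) * ((∑ k ∈ range ((gr M).card + 1), capCount M k p : ℕ) : ℤ) ≤
        2 * ((∑ k ∈ range ((gr M).card + 1), k * capCount M k p : ℕ) : ℤ) := by
      exact_mod_cast h1
    rw [h4] at h2
    linarith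

end PercRepro.Cogirth
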